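import Mathlib
import HarnessLib
import Summits.HubbardSuperconductivity.HubbardSuperconductivity.Theorems.KLProgrammeKLRegimeEngineTwoLegStepSuccDoorProfile
import Summits.HubbardSuperconductivity.HubbardSuperconductivity.Theorems.KLProgrammeKLRegimeEngineTwoLegStepSuccDoorMS

/-!
# K3 ENGINE child `KLRegimeEngineV16` (stmt-HubbardSuperconductivity-20236): the (e)-doors at `n + 1`, PACKAGE-PARAMETRIC
# (plan g16 (R25)/(R25′): v5 raises the engine package to (klEngGeo6, klEngQ6 P R); thresholds klEngC₃3 / klEngU₀4 / klEngL₃ / klEngM₃ unchanged)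

Cell gate-hubbard-kl, seat hubbard-kl-r2d-p1 (g4).  The doors of `…TwoLegStepSuccDoorProfile` (p519360/p520249) are keyed on the gen-6 witness package
`(klEngGeo5, klEngQ5 P R)`; (R25) moves 20236's skeleton to a RAISED package.  Since every theorem underneath is `(G, Q)`-generic (p1b's
`twoLegCoreTD_succ_of_profileData`, k3c4-p1's `twoLegStepV16_of_cores_of_nestedLegs`, k3c3-p1's `twoLegSizesMSTQ_succ_of_pieces_mixed`, p2's
`TwoLegCurveJetBound.mono`, `profileFit_of_curveJetBar_div`), the doors are restated here for an ARBITRARY package `(G, Q)` under the UNCHANGED stub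
thresholds — so the v5 (and any later) skeleton instantiates them with one line (`G := klEngGeo6`, `Q := klEngQ6 P R`, the sign `0 ≤ Q.CL β (n+1)` and the
size-field facts from the package's `WF`):

* `twoLegSizesMSTQ_succ_of_pieces_mixed_pkg` — conjunct (B) at any `(G, Q)` under the stub thresholds (continuity + `/16` discharged);
* **`twoLegStepV16_succ_of_profileData_pkg`** — the slot at `n + 1` from p1b's profile data (angular jets `A`, fit, near response, far values, field
  strength, shell-tube gradient) + (B) by name + (C) nested legs, at any `(G, Q)`;
* **`twoLegStepV16_succ_of_curveJetsDiv_pkg`** — the same with the jets DISCHARGED from `TwoLegCurveJetBound L M (G.S/X) (Q.S'/X) … (n+1)` for any table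
  `X` dominating the chain-rule numerals (`X 0 ≥ 4441`, `X 1 ≥ 2.6·10¹¹`, `X 2 ≥ 3.6·10¹⁰`; size fields nonnegative and monotone at order 1 → 2);
* **`twoLegStepV16_succ_of_curveJetsNat_pkg`** — the same from the NATURAL-CONSTANTS insert `TwoLegCurveJetBound L M cN cN' … (n+1)` ((R25)(b): stub 6 and
  the (M)/(e) inserts at c4a's tables) plus the two PACKAGE INEQUALITIES `cN k ≤ G.S k / X k`, `cN' k ≤ Q.S' k / X k` (k3c2-p2's `…DefsG6Q6` lemmas) —
  what the v5 composition's (e) proof calls.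

Proofs only (compositions); no definitions; nothing about the model is asserted.  References: BGM 2006 §2.4 (2.36) [cite: BenfattoGiulianiMastropietro2006];
KL STATUS 2026-08-27T09:50:22Z (R25), 09:52:54Z (R25′).
-/

noncomputable section

namespace Summit.HubbardSuperconductivity.HubbardSuperconductivity.Theorems.EngineV8

set_option linter.dupNamespace false -- summit = problem name (single-conjunct summit), D-0017

open Real Finset Literature.MathematicalPhysics.QuantumLattice Literature.Probability.LatticeModels
open Literature.MathematicalPhysics.QuantumLattice.FermiRG Literature.MathematicalPhysics.QuantumLattice.BandSectorCounting
open Summit.HubbardSuperconductivity.HubbardSuperconductivity.Theorems.KLProgrammeLegKernels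
open Summit.HubbardSuperconductivity.HubbardSuperconductivity.Theorems.DispersionFlow
open Summit.HubbardSuperconductivity.HubbardSuperconductivity.Theorems.PerturbedFermiCurve
open Summit.HubbardSuperconductivity.HubbardSuperconductivity.Theorems.KLRegimeSplit

/-! ## §1 Conjunct (B) at any package under the stub thresholds -/

section MS

variable {L M : ℕ} [NeZero L] [NeZero M]

/-- **(B) `TwoLegSizesMSTQ … (n+1)` AT ANY PACKAGE `(G, Q)` under the stub's thresholds** (k3c3-p1's `twoLegSizesMSTQ_succ_of_pieces_mixed`;
thresholds `/16` and the continuity of the local parts discharged). -/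
theorem twoLegSizesMSTQ_succ_of_pieces_mixed_pkg (G : GeoConsts) (Q : EngConsts) {P : SplitConsts} {R : RenConsts} {c : ℝ} (hR : R.WF2) (hc : 0 < c)
    (hc3 : c ≤ klEngC₃3 P R) {μ : ℝ} (hμ : μ ∈ klWindowC) {U : ℝ} (hU : 0 < U) (hUle : U ≤ klEngU₀4 P R c) {β : ℝ} (hβ : klBetaMin ≤ β)
    (hβc : β ≤ Real.exp (c / U ^ 2)) {K : TrigPolyC4v} (hK : FrameOK R U (nScales β) μ K) {n : ℕ} (hn : n + 1 ≤ nScales β)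
    {Kp : ℕ → TrigPolyC4v} (hKp : ∀ p : Fin 2 → ℝ, K.eval p = ∑ m ∈ range (nScales β + 1), (Kp m).eval p)
    (ha : ∀ m ≤ nScales β, ∀ j ≤ 4, ∀ q : Momentum, ‖iteratedFDeriv ℝ j (evalM (Kp m)) q‖ ≤ pieceSize R U m j)
    (d : ℕ)
    {S : ℕ → TrigPolyC4v}
    (hS : ∀ θ, klLocalPart L M β U μ K (n + 1) θ - klLocalPart L M β U μ K n θ =
      (S (nScales β - (n + 1))).eval (klFermiPoint μ K θ))
    {σ : ℕ → ℕ → ℝ} (hσnn : ∀ k l, 0 ≤ σ k l)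
    (hσ0 : ∀ k ≤ nScales β - (n + 1), ∀ q : Momentum, |evalM (S k) q| ≤ σ k 0)
    (hσ : ∀ k ≤ nScales β - (n + 1), ∀ l, 1 ≤ l → l ≤ 5 → ∀ q : Momentum, ‖iteratedFDeriv ℝ l (evalM (S k)) q‖ ≤ σ k l)
    {ε : ℕ → ℕ → ℝ} (hεnn : ∀ m l, 0 ≤ ε m l)
    (hε0 : ∀ m ∈ Ioc (n + 1) (nScales β), ∀ q : Momentum, |evalM (fsub (S (m - (n + 1))) (S (m - (n + 1) - 1))) q| ≤ ε m 0)
    (hε : ∀ m ∈ Ioc (n + 1) (nScales β), ∀ l, 1 ≤ l → l ≤ 4 → ∀ q : Momentum,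
      ‖iteratedFDeriv ℝ l (evalM (fsub (S (m - (n + 1))) (S (m - (n + 1) - 1)))) q‖ ≤ ε m l)
    {X : ℝ} (hX : ∀ l ≤ 4, ∀ x : ℝ, ‖iteratedFDeriv ℝ l salmhoferCutoff x‖ ≤ X)
    (hfit_n : ∀ j ≤ 4, msPieceBaseL X σ R U (n + 1) (msLam R U d (n + 1) 3) (msLam R U d (n + 1) 4) j ≤ twoLegBar G Q U j (n + 1))
    (hfit_m : ∀ m ∈ Ioc (n + 1) (nScales β), ∀ j ≤ 4,
      msPieceSlotL X σ ε R c U d (n + 1) (msLam R U d (n + 1) 3) (msLam R U d (n + 1) 4) m j ≤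
        msBarQ G Q U (n + 1) * (R.Gfr j * uPow j U * (4 : ℝ) ^ (((j : ℤ) - 2) * m))) :
    TwoLegSizesMSTQ L M G Q R β U μ K (n + 1) :=
  have hR' : ∀ j, 0 ≤ R.Gfr j := hR.1.2.2
  twoLegSizesMSTQ_succ_of_pieces_mixed (L := L) (M := M) hR' hc (le_klCurveC3_div_sixteen_of_le_klEngC₃3 hR' hc3) hU
    (le_klCurveU0_div_sixteen_of_le_klEngU₀4 hR' hUle) hβ hβc hμ hKp ha hn d
    (continuous_klLocalPart_stub hR hc hc3 hU hUle hβ hβc hμ hK L M (n + 1)) (continuous_klLocalPart_stub hR hc hc3 hU hUle hβ hβc hμ hK L M n)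
    hS hσnn hσ0 hσ hεnn hε0 hε hX hfit_n hfit_m


end MS

/-! ## §2 The profile door at any package -/

/-- **THE (e)-DOOR AT `n + 1`, PROFILE DATA, ANY PACKAGE `(G, Q)`** — under (e)'s literal binders with the witness package replaced by an arbitrary
`(G, Q)` (thresholds unchanged) and the sign `0 ≤ Q.CL β (n+1)`: `TwoLegStepV16 L M G P Q R β U μ K (n+1)` from p1b's profile data, (B) by name, (C). -/
theorem twoLegStepV16_succ_of_profileData_pkg (G : GeoConsts) (Q : EngConsts) (P : SplitConsts) (R : RenConsts) (c : ℝ) (hP : P.WF) (hR : R.WF2) (hc : 0 < c)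
    (hc3 : c ≤ klEngC₃3 P R) (μ : ℝ) (hμ : μ ∈ klWindowC) (U : ℝ) (hU : 0 < U) (hUle : U ≤ klEngU₀4 P R c) (β : ℝ) (hβ : klBetaMin ≤ β)
    (hβc : β ≤ Real.exp (c / U ^ 2)) (K : TrigPolyC4v) (hK : FrameOKDeg R U (nScales β) μ K) (L M : ℕ) [NeZero L] [NeZero M]
    (hL : klEngL₃ β U ≤ L) (hM : klEngM₃ β U L ≤ M) (n : ℕ) (hn : n + 1 ≤ nScales β + 1) (hreg : IsKLRegime U c (-((n + 1 : ℕ) : ℤ)))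
    (hhist : HistP klPredsV16 L M G P Q R β U μ K (n + 1))
    (hE : EngineBoundsAtV10S L M G P Q β U μ K (n + 1))
    (hCL : 0 ≤ Q.CL β (n + 1))
    -- (A) the profile-keyed inputs of the core at scale `n + 1`
    {A : ℕ → ℝ}
    (hA0 : ∀ θ : ℝ, |klLocalPart L M β U μ K (n + 1) θ - klLocalPart L M β U μ K n θ| ≤ A 0)
    (hA1 : ∀ θ : ℝ, |deriv (fun θ => klLocalPart L M β U μ K (n + 1) θ - klLocalPart L M β U μ K n θ) θ| ≤ A 1)
    (hA2 : ∀ θ : ℝ, |iteratedDeriv 2 (fun θ => klLocalPart L M β U μ K (n + 1) θ - klLocalPart L M β U μ K n θ) θ| ≤ A 2)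
    (hfitS : ∀ j ≤ 2, (if j = 0 then A 0 else 0) +
      (j.factorial : ℝ) ^ 2 * (2 * j.factorial * 1110 * 200 ^ j) *
        (if j = 0 then 2 * A 0 else (2 * π + 1) * A 1 + (if j = 2 then A 2 else 0)) *
        (4 + max 1 (((j - 1).factorial : ℝ) / (8 / 5))) ^ j ≤ twoLegBar G Q U j (n + 1))
    {d ρ : ℝ} (hd : 0 < d)
    (hnear : ∀ K' : TrigPolyC4v, FrameOKDeg R U (klTempScaleIdx β klE0) μ K' →
      (∀ j < n + 1, histV15 L M G P Q R β U μ K' j) → frameDist K K' ≤ d → ∀ θ : ℝ,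
      |(klLocalPart L M β U μ K (n + 1) θ - klLocalPart L M β U μ K n θ) -
        (klLocalPart L M β U μ K' (n + 1) θ - klLocalPart L M β U μ K' n θ)| ≤ ρ * frameDist K K')
    (hvK' : ∀ K' : TrigPolyC4v, FrameOKDeg R U (klTempScaleIdx β klE0) μ K' →
      (∀ j < n + 1, histV15 L M G P Q R β U μ K' j) → ∀ θ : ℝ,
      |klLocalPart L M β U μ K' (n + 1) θ - klLocalPart L M β U μ K' n θ| ≤ A 0)
    (hfitL : ρ ≤ lipBar G Q U (n + 1)) (hfar : 2 * A 0 ≤ lipBar G Q U (n + 1) * d)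
    (hz : ∀ k ∈ klShell L μ K (n + 1), |klFieldStrength L M β U μ K (n + 1) k - 1| ≤ R.cz * |U|)
    {m₁' : ℝ}
    (hm₁' : ∀ q : Momentum, |frameLevel μ K q| ≤ klScale klE0 (n + 1) →
      ‖fderiv ℝ (evalM (symInterp L (fun p => klLocSelfEnergyRe L M β U μ K (n + 1) p - K.eval (latticeMomentum L p)))) q‖ ≤ m₁')
    (hfit1 : m₁' + 4 / 3 * R.Gfr 1 * U ^ 2 ≤ R.cz * |U| * (cDtmin (-1.2) (-0.05) / 2))
    -- (B) the multi-slot sizes at scale `n + 1`, by name (opened in `…TwoLegStepSuccDoorMS`)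
    (hms : TwoLegSizesMSTQ L M G Q R β U μ K (n + 1))

    -- (C) the two nested-leg rates at scale `n + 1`
    (hcut : ∀ (Mq : ℕ → ℕ) (L₁ M₁ M₂ : ℕ) [NeZero L₁] [NeZero M₁] [NeZero M₂], L ≤ L₁ → Q.M0 β L₁ ≤ M₁ → Mq L₁ ≤ M₁ → M₁ ≤ M₂ →
      (∀ j < n + 1, histV15 L₁ M₁ G P Q R β U μ K j ∧
        TwoLegCoreTD L₁ M₁ (histV15 L₁ M₁ G P Q R β U μ) G P Q R β U μ K j ∧
          TwoLegSizesMSTQ L₁ M₁ G Q R β U μ K j) →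
      (∀ j < n + 1, histV15 L₁ M₂ G P Q R β U μ K j ∧
        TwoLegCoreTD L₁ M₂ (histV15 L₁ M₂ G P Q R β U μ) G P Q R β U μ K j ∧
          TwoLegSizesMSTQ L₁ M₂ G Q R β U μ K j) →
        ∀ θ : ℝ, |klLocalPart L₁ M₁ β U μ K (n + 1) θ - klLocalPart L₁ M₂ β U μ K (n + 1) θ| ≤ Q.CL β (n + 1) / 4 / L₁)
    (hsp : ∀ (Mq : ℕ → ℕ) (L₁ L₂ M₂ : ℕ) [NeZero L₁] [NeZero L₂] [NeZero M₂], L ≤ L₁ → L₁ ∣ L₂ → Q.M0 β L₁ ≤ M₂ → Mq L₁ ≤ M₂ →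
      Q.M0 β L₂ ≤ M₂ → Mq L₂ ≤ M₂ →
      (∀ j < n + 1, histV15 L₁ M₂ G P Q R β U μ K j ∧
        TwoLegCoreTD L₁ M₂ (histV15 L₁ M₂ G P Q R β U μ) G P Q R β U μ K j ∧
          TwoLegSizesMSTQ L₁ M₂ G Q R β U μ K j) →
      (∀ j < n + 1, histV15 L₂ M₂ G P Q R β U μ K j ∧
        TwoLegCoreTD L₂ M₂ (histV15 L₂ M₂ G P Q R β U μ) G P Q R β U μ K j ∧
          TwoLegSizesMSTQ L₂ M₂ G Q R β U μ K j) →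
        ∀ θ : ℝ, |klLocalPart L₁ M₂ β U μ K (n + 1) θ - klLocalPart L₂ M₂ β U μ K (n + 1) θ| ≤ Q.CL β (n + 1) / 4 / L₁) :
    TwoLegStepV16 L M G P Q R β U μ K (n + 1) := by
  have _ := hP; have _ := hn; have _ := hreg; have _ := hhist; have _ := hE; have _ := hM
  have hR' : ∀ j, 0 ≤ R.Gfr j := hR.1.2.2
  have hcore : TwoLegCoreTD L M (histV15 L M G P Q R β U μ) G P Q R β U μ K (n + 1) :=
    twoLegCoreTD_succ_of_profileData (L := L) (M := M) hR' hc (hc3.trans (klEngC₃3_le_klCurveC3 P hR')) hU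
      ((le_klEngU₀3_of_le_klEngU₀4 hUle).trans (klEngU₀3_le_klCurveU0 P hR' c)) hβ hβc hμ hK hL
      (histV15 L M G P Q R β U μ) G P Q n hA0 hA1 hA2 hfitS hd hnear hvK' hfitL hfar hz hm₁' hfit1
  exact twoLegStepV16_of_cores_of_nestedLegs hcore hms hCL hcut hsp

/-! ## §3 The stub-6-keyed doors at any package: divided constants; natural constants + package inequalities -/

/-- **THE (e)-DOOR AT `n + 1`, JETS FROM STUB 6 WITH DIVIDED CONSTANTS, ANY PACKAGE** — (E3a) discharged from
`TwoLegCurveJetBound L M (G.S/X) (Q.S'/X) β U μ K (n+1)` for size fields nonnegative and monotone at order 1 → 2 and a table `X` dominating the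
chain-rule numerals (`profileFit_of_curveJetBar_div`). -/
theorem twoLegStepV16_succ_of_curveJetsDiv_pkg (G : GeoConsts) (Q : EngConsts) (P : SplitConsts) (R : RenConsts) (c : ℝ) (hP : P.WF) (hR : R.WF2) (hc : 0 < c)
    (hc3 : c ≤ klEngC₃3 P R) (μ : ℝ) (hμ : μ ∈ klWindowC) (U : ℝ) (hU : 0 < U) (hUle : U ≤ klEngU₀4 P R c) (β : ℝ) (hβ : klBetaMin ≤ β)
    (hβc : β ≤ Real.exp (c / U ^ 2)) (K : TrigPolyC4v) (hK : FrameOKDeg R U (nScales β) μ K) (L M : ℕ) [NeZero L] [NeZero M]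
    (hL : klEngL₃ β U ≤ L) (hM : klEngM₃ β U L ≤ M) (n : ℕ) (hn : n + 1 ≤ nScales β + 1) (hreg : IsKLRegime U c (-((n + 1 : ℕ) : ℤ)))
    (hhist : HistP klPredsV16 L M G P Q R β U μ K (n + 1))
    (hE : EngineBoundsAtV10S L M G P Q β U μ K (n + 1))
    (hCL : 0 ≤ Q.CL β (n + 1)) (hS : ∀ k, 0 ≤ G.S k) (hS' : ∀ k, 0 ≤ Q.S' k) (hS12 : G.S 1 ≤ G.S 2) (hS'12 : Q.S' 1 ≤ Q.S' 2)
    -- (A) stub 6's conclusion at scale `n + 1`, divided constants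
    {X : ℕ → ℝ} (hX0 : 4441 ≤ X 0) (hX1 : 2.6e11 ≤ X 1) (hX2 : 3.6e10 ≤ X 2)
    (hJ : TwoLegCurveJetBound L M (fun k => G.S k / X k) (fun k => Q.S' k / X k) β U μ K (n + 1))
    {d ρ : ℝ} (hd : 0 < d)
    (hnear : ∀ K' : TrigPolyC4v, FrameOKDeg R U (klTempScaleIdx β klE0) μ K' →
      (∀ j < n + 1, histV15 L M G P Q R β U μ K' j) → frameDist K K' ≤ d → ∀ θ : ℝ,
      |(klLocalPart L M β U μ K (n + 1) θ - klLocalPart L M β U μ K n θ) -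
        (klLocalPart L M β U μ K' (n + 1) θ - klLocalPart L M β U μ K' n θ)| ≤ ρ * frameDist K K')
    (hvK' : ∀ K' : TrigPolyC4v, FrameOKDeg R U (klTempScaleIdx β klE0) μ K' →
      (∀ j < n + 1, histV15 L M G P Q R β U μ K' j) → ∀ θ : ℝ,
      |klLocalPart L M β U μ K' (n + 1) θ - klLocalPart L M β U μ K' n θ| ≤ curveJetBar (fun k => G.S k / X k) (fun k => Q.S' k / X k) U 0 (n + 1))
    (hfitL : ρ ≤ lipBar G Q U (n + 1)) (hfar : 2 * curveJetBar (fun k => G.S k / X k) (fun k => Q.S' k / X k) U 0 (n + 1) ≤ lipBar G Q U (n + 1) * d)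
    (hz : ∀ k ∈ klShell L μ K (n + 1), |klFieldStrength L M β U μ K (n + 1) k - 1| ≤ R.cz * |U|)
    {m₁' : ℝ}
    (hm₁' : ∀ q : Momentum, |frameLevel μ K q| ≤ klScale klE0 (n + 1) →
      ‖fderiv ℝ (evalM (symInterp L (fun p => klLocSelfEnergyRe L M β U μ K (n + 1) p - K.eval (latticeMomentum L p)))) q‖ ≤ m₁')
    (hfit1 : m₁' + 4 / 3 * R.Gfr 1 * U ^ 2 ≤ R.cz * |U| * (cDtmin (-1.2) (-0.05) / 2))
    -- (B) the multi-slot sizes at scale `n + 1`, by name (opened in `…TwoLegStepSuccDoorMS`)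
    (hms : TwoLegSizesMSTQ L M G Q R β U μ K (n + 1))

    -- (C) the two nested-leg rates at scale `n + 1`
    (hcut : ∀ (Mq : ℕ → ℕ) (L₁ M₁ M₂ : ℕ) [NeZero L₁] [NeZero M₁] [NeZero M₂], L ≤ L₁ → Q.M0 β L₁ ≤ M₁ → Mq L₁ ≤ M₁ → M₁ ≤ M₂ →
      (∀ j < n + 1, histV15 L₁ M₁ G P Q R β U μ K j ∧
        TwoLegCoreTD L₁ M₁ (histV15 L₁ M₁ G P Q R β U μ) G P Q R β U μ K j ∧
          TwoLegSizesMSTQ L₁ M₁ G Q R β U μ K j) →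
      (∀ j < n + 1, histV15 L₁ M₂ G P Q R β U μ K j ∧
        TwoLegCoreTD L₁ M₂ (histV15 L₁ M₂ G P Q R β U μ) G P Q R β U μ K j ∧
          TwoLegSizesMSTQ L₁ M₂ G Q R β U μ K j) →
        ∀ θ : ℝ, |klLocalPart L₁ M₁ β U μ K (n + 1) θ - klLocalPart L₁ M₂ β U μ K (n + 1) θ| ≤ Q.CL β (n + 1) / 4 / L₁)
    (hsp : ∀ (Mq : ℕ → ℕ) (L₁ L₂ M₂ : ℕ) [NeZero L₁] [NeZero L₂] [NeZero M₂], L ≤ L₁ → L₁ ∣ L₂ → Q.M0 β L₁ ≤ M₂ → Mq L₁ ≤ M₂ →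
      Q.M0 β L₂ ≤ M₂ → Mq L₂ ≤ M₂ →
      (∀ j < n + 1, histV15 L₁ M₂ G P Q R β U μ K j ∧
        TwoLegCoreTD L₁ M₂ (histV15 L₁ M₂ G P Q R β U μ) G P Q R β U μ K j ∧
          TwoLegSizesMSTQ L₁ M₂ G Q R β U μ K j) →
      (∀ j < n + 1, histV15 L₂ M₂ G P Q R β U μ K j ∧
        TwoLegCoreTD L₂ M₂ (histV15 L₂ M₂ G P Q R β U μ) G P Q R β U μ K j ∧
          TwoLegSizesMSTQ L₂ M₂ G Q R β U μ K j) →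
        ∀ θ : ℝ, |klLocalPart L₁ M₂ β U μ K (n + 1) θ - klLocalPart L₂ M₂ β U μ K (n + 1) θ| ≤ Q.CL β (n + 1) / 4 / L₁) :
    TwoLegStepV16 L M G P Q R β U μ K (n + 1) := by
  have hA0 : ∀ θ : ℝ, |klLocalPart L M β U μ K (n + 1) θ - klLocalPart L M β U μ K n θ| ≤
      curveJetBar (fun k => G.S k / X k) (fun k => Q.S' k / X k) U 0 (n + 1) := fun θ => by
    simpa only [klTwoLegCurveProfile_succ] using hJ.abs_le θ
  have hA1 : ∀ θ : ℝ, |deriv (fun θ => klLocalPart L M β U μ K (n + 1) θ - klLocalPart L M β U μ K n θ) θ| ≤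
      curveJetBar (fun k => G.S k / X k) (fun k => Q.S' k / X k) U 1 (n + 1) := fun θ => by
    simpa only [iteratedDeriv_one, klTwoLegCurveProfile_succ] using hJ.le (k := 1) (by norm_num) θ
  have hA2 : ∀ θ : ℝ, |iteratedDeriv 2 (fun θ => klLocalPart L M β U μ K (n + 1) θ - klLocalPart L M β U μ K n θ) θ| ≤
      curveJetBar (fun k => G.S k / X k) (fun k => Q.S' k / X k) U 2 (n + 1) := fun θ => by
    simpa only [klTwoLegCurveProfile_succ] using hJ.le (k := 2) (by norm_num) θ
  exact twoLegStepV16_succ_of_profileData_pkg G Q P R c hP hR hc hc3 μ hμ U hU hUle β hβ hβc K hK L M hL hM n hn hreg hhist hE hCL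
    (A := fun k => curveJetBar (fun k => G.S k / X k) (fun k => Q.S' k / X k) U k (n + 1)) hA0 hA1 hA2
    (profileFit_of_curveJetBar_div hS hS' hS12 hS'12 hX0 hX1 hX2 U (n + 1)) hd hnear hvK' hfitL hfar hz hm₁' hfit1 hms hcut hsp

/-- **THE (e)-DOOR AT `n + 1`, JETS FROM THE NATURAL-CONSTANTS INSERT + PACKAGE INEQUALITIES, ANY PACKAGE** ((R25)(b)/(R25′)(A)): from
`hJ : TwoLegCurveJetBound L M cN cN' β U μ K (n+1)` (stub 6 / the (e) insert at c4a's tables `cN, cN'`) and the package inequalities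
`cN k ≤ G.S k / X k`, `cN' k ≤ Q.S' k / X k` (`TwoLegCurveJetBound.mono`), the slot follows as in `twoLegStepV16_succ_of_curveJetsDiv_pkg`. -/
theorem twoLegStepV16_succ_of_curveJetsNat_pkg (G : GeoConsts) (Q : EngConsts) (P : SplitConsts) (R : RenConsts) (c : ℝ) (hP : P.WF) (hR : R.WF2) (hc : 0 < c)
    (hc3 : c ≤ klEngC₃3 P R) (μ : ℝ) (hμ : μ ∈ klWindowC) (U : ℝ) (hU : 0 < U) (hUle : U ≤ klEngU₀4 P R c) (β : ℝ) (hβ : klBetaMin ≤ β)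
    (hβc : β ≤ Real.exp (c / U ^ 2)) (K : TrigPolyC4v) (hK : FrameOKDeg R U (nScales β) μ K) (L M : ℕ) [NeZero L] [NeZero M]
    (hL : klEngL₃ β U ≤ L) (hM : klEngM₃ β U L ≤ M) (n : ℕ) (hn : n + 1 ≤ nScales β + 1) (hreg : IsKLRegime U c (-((n + 1 : ℕ) : ℤ)))
    (hhist : HistP klPredsV16 L M G P Q R β U μ K (n + 1))
    (hE : EngineBoundsAtV10S L M G P Q β U μ K (n + 1))
    (hCL : 0 ≤ Q.CL β (n + 1)) (hS : ∀ k, 0 ≤ G.S k) (hS' : ∀ k, 0 ≤ Q.S' k) (hS12 : G.S 1 ≤ G.S 2) (hS'12 : Q.S' 1 ≤ Q.S' 2)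
    -- (A) the natural-constants insert at scale `n + 1` and the package inequalities
    {X : ℕ → ℝ} (hX0 : 4441 ≤ X 0) (hX1 : 2.6e11 ≤ X 1) (hX2 : 3.6e10 ≤ X 2)
    {cN cN' : ℕ → ℝ} (hJ : TwoLegCurveJetBound L M cN cN' β U μ K (n + 1))
    (hpk : ∀ k, cN k ≤ G.S k / X k) (hpk' : ∀ k, cN' k ≤ Q.S' k / X k)
    {d ρ : ℝ} (hd : 0 < d)
    (hnear : ∀ K' : TrigPolyC4v, FrameOKDeg R U (klTempScaleIdx β klE0) μ K' →
      (∀ j < n + 1, histV15 L M G P Q R β U μ K' j) → frameDist K K' ≤ d → ∀ θ : ℝ,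
      |(klLocalPart L M β U μ K (n + 1) θ - klLocalPart L M β U μ K n θ) -
        (klLocalPart L M β U μ K' (n + 1) θ - klLocalPart L M β U μ K' n θ)| ≤ ρ * frameDist K K')
    (hvK' : ∀ K' : TrigPolyC4v, FrameOKDeg R U (klTempScaleIdx β klE0) μ K' →
      (∀ j < n + 1, histV15 L M G P Q R β U μ K' j) → ∀ θ : ℝ,
      |klLocalPart L M β U μ K' (n + 1) θ - klLocalPart L M β U μ K' n θ| ≤ curveJetBar (fun k => G.S k / X k) (fun k => Q.S' k / X k) U 0 (n + 1))
    (hfitL : ρ ≤ lipBar G Q U (n + 1)) (hfar : 2 * curveJetBar (fun k => G.S k / X k) (fun k => Q.S' k / X k) U 0 (n + 1) ≤ lipBar G Q U (n + 1) * d)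
    (hz : ∀ k ∈ klShell L μ K (n + 1), |klFieldStrength L M β U μ K (n + 1) k - 1| ≤ R.cz * |U|)
    {m₁' : ℝ}
    (hm₁' : ∀ q : Momentum, |frameLevel μ K q| ≤ klScale klE0 (n + 1) →
      ‖fderiv ℝ (evalM (symInterp L (fun p => klLocSelfEnergyRe L M β U μ K (n + 1) p - K.eval (latticeMomentum L p)))) q‖ ≤ m₁')
    (hfit1 : m₁' + 4 / 3 * R.Gfr 1 * U ^ 2 ≤ R.cz * |U| * (cDtmin (-1.2) (-0.05) / 2))
    -- (B) the multi-slot sizes at scale `n + 1`, by name (opened in `…TwoLegStepSuccDoorMS`)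
    (hms : TwoLegSizesMSTQ L M G Q R β U μ K (n + 1))

    -- (C) the two nested-leg rates at scale `n + 1`
    (hcut : ∀ (Mq : ℕ → ℕ) (L₁ M₁ M₂ : ℕ) [NeZero L₁] [NeZero M₁] [NeZero M₂], L ≤ L₁ → Q.M0 β L₁ ≤ M₁ → Mq L₁ ≤ M₁ → M₁ ≤ M₂ →
      (∀ j < n + 1, histV15 L₁ M₁ G P Q R β U μ K j ∧
        TwoLegCoreTD L₁ M₁ (histV15 L₁ M₁ G P Q R β U μ) G P Q R β U μ K j ∧
          TwoLegSizesMSTQ L₁ M₁ G Q R β U μ K j) →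
      (∀ j < n + 1, histV15 L₁ M₂ G P Q R β U μ K j ∧
        TwoLegCoreTD L₁ M₂ (histV15 L₁ M₂ G P Q R β U μ) G P Q R β U μ K j ∧
          TwoLegSizesMSTQ L₁ M₂ G Q R β U μ K j) →
        ∀ θ : ℝ, |klLocalPart L₁ M₁ β U μ K (n + 1) θ - klLocalPart L₁ M₂ β U μ K (n + 1) θ| ≤ Q.CL β (n + 1) / 4 / L₁)
    (hsp : ∀ (Mq : ℕ → ℕ) (L₁ L₂ M₂ : ℕ) [NeZero L₁] [NeZero L₂] [NeZero M₂], L ≤ L₁ → L₁ ∣ L₂ → Q.M0 β L₁ ≤ M₂ → Mq L₁ ≤ M₂ →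
      Q.M0 β L₂ ≤ M₂ → Mq L₂ ≤ M₂ →
      (∀ j < n + 1, histV15 L₁ M₂ G P Q R β U μ K j ∧
        TwoLegCoreTD L₁ M₂ (histV15 L₁ M₂ G P Q R β U μ) G P Q R β U μ K j ∧
          TwoLegSizesMSTQ L₁ M₂ G Q R β U μ K j) →
      (∀ j < n + 1, histV15 L₂ M₂ G P Q R β U μ K j ∧
        TwoLegCoreTD L₂ M₂ (histV15 L₂ M₂ G P Q R β U μ) G P Q R β U μ K j ∧
          TwoLegSizesMSTQ L₂ M₂ G Q R β U μ K j) →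
        ∀ θ : ℝ, |klLocalPart L₁ M₂ β U μ K (n + 1) θ - klLocalPart L₂ M₂ β U μ K (n + 1) θ| ≤ Q.CL β (n + 1) / 4 / L₁) :
    TwoLegStepV16 L M G P Q R β U μ K (n + 1) :=
  twoLegStepV16_succ_of_curveJetsDiv_pkg G Q P R c hP hR hc hc3 μ hμ U hU hUle β hβ hβc K hK L M hL hM n hn hreg hhist hE hCL hS hS' hS12 hS'12
    hX0 hX1 hX2 (TwoLegCurveJetBound.mono hpk hpk' hJ) hd hnear hvK' hfitL hfar hz hm₁' hfit1 hms hcut hsp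

/-! ## §4 (appended) The k ≤ 2 form ((R26): stub 6 / the inserts are `TwoLegCurveJetBound2` — C⁴ + jets of order ≤ 2 only).  Keyed on the RAW
jets clause, so the (e) prover passes the second conjunct of the insert whatever the landed predicate is called. -/

/-- **THE (e)-DOOR AT `n + 1` FROM THE ORDER-≤-2 JETS CLAUSE + PACKAGE INEQUALITIES, ANY PACKAGE** — as `twoLegStepV16_succ_of_curveJetsNat_pkg`
but taking only `hjets : ∀ k ≤ 2, ∀ θ, |iteratedDeriv k (klTwoLegCurveProfile … (n+1)) θ| ≤ curveJetBar cN cN' U k (n+1)` (= the bound conjunct of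
(R26)'s `TwoLegCurveJetBound2 L M cN cN' … (n+1)`, e.g. `hInsert.2`) and the package inequalities `cN k ≤ G.S k / X k`, `cN' k ≤ Q.S' k / X k`
(`curveJetBar_mono`). -/
theorem twoLegStepV16_succ_of_jets2Nat_pkg (G : GeoConsts) (Q : EngConsts) (P : SplitConsts) (R : RenConsts) (c : ℝ) (hP : P.WF) (hR : R.WF2) (hc : 0 < c)
    (hc3 : c ≤ klEngC₃3 P R) (μ : ℝ) (hμ : μ ∈ klWindowC) (U : ℝ) (hU : 0 < U) (hUle : U ≤ klEngU₀4 P R c) (β : ℝ) (hβ : klBetaMin ≤ β)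
    (hβc : β ≤ Real.exp (c / U ^ 2)) (K : TrigPolyC4v) (hK : FrameOKDeg R U (nScales β) μ K) (L M : ℕ) [NeZero L] [NeZero M]
    (hL : klEngL₃ β U ≤ L) (hM : klEngM₃ β U L ≤ M) (n : ℕ) (hn : n + 1 ≤ nScales β + 1) (hreg : IsKLRegime U c (-((n + 1 : ℕ) : ℤ)))
    (hhist : HistP klPredsV16 L M G P Q R β U μ K (n + 1))
    (hE : EngineBoundsAtV10S L M G P Q β U μ K (n + 1))
    (hCL : 0 ≤ Q.CL β (n + 1)) (hS : ∀ k, 0 ≤ G.S k) (hS' : ∀ k, 0 ≤ Q.S' k) (hS12 : G.S 1 ≤ G.S 2) (hS'12 : Q.S' 1 ≤ Q.S' 2)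
    -- (A) the order-≤-2 jets of the increment profile at natural constants, and the package inequalities
    {X : ℕ → ℝ} (hX0 : 4441 ≤ X 0) (hX1 : 2.6e11 ≤ X 1) (hX2 : 3.6e10 ≤ X 2)
    {cN cN' : ℕ → ℝ}
    (hjets : ∀ k ≤ 2, ∀ θ : ℝ, |iteratedDeriv k (klTwoLegCurveProfile L M β U μ K (n + 1)) θ| ≤ curveJetBar cN cN' U k (n + 1))
    (hpk : ∀ k, cN k ≤ G.S k / X k) (hpk' : ∀ k, cN' k ≤ Q.S' k / X k)
    {d ρ : ℝ} (hd : 0 < d)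
    (hnear : ∀ K' : TrigPolyC4v, FrameOKDeg R U (klTempScaleIdx β klE0) μ K' →
      (∀ j < n + 1, histV15 L M G P Q R β U μ K' j) → frameDist K K' ≤ d → ∀ θ : ℝ,
      |(klLocalPart L M β U μ K (n + 1) θ - klLocalPart L M β U μ K n θ) -
        (klLocalPart L M β U μ K' (n + 1) θ - klLocalPart L M β U μ K' n θ)| ≤ ρ * frameDist K K')
    (hvK' : ∀ K' : TrigPolyC4v, FrameOKDeg R U (klTempScaleIdx β klE0) μ K' →
      (∀ j < n + 1, histV15 L M G P Q R β U μ K' j) → ∀ θ : ℝ,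
      |klLocalPart L M β U μ K' (n + 1) θ - klLocalPart L M β U μ K' n θ| ≤ curveJetBar (fun k => G.S k / X k) (fun k => Q.S' k / X k) U 0 (n + 1))
    (hfitL : ρ ≤ lipBar G Q U (n + 1)) (hfar : 2 * curveJetBar (fun k => G.S k / X k) (fun k => Q.S' k / X k) U 0 (n + 1) ≤ lipBar G Q U (n + 1) * d)
    (hz : ∀ k ∈ klShell L μ K (n + 1), |klFieldStrength L M β U μ K (n + 1) k - 1| ≤ R.cz * |U|)
    {m₁' : ℝ}
    (hm₁' : ∀ q : Momentum, |frameLevel μ K q| ≤ klScale klE0 (n + 1) →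
      ‖fderiv ℝ (evalM (symInterp L (fun p => klLocSelfEnergyRe L M β U μ K (n + 1) p - K.eval (latticeMomentum L p)))) q‖ ≤ m₁')
    (hfit1 : m₁' + 4 / 3 * R.Gfr 1 * U ^ 2 ≤ R.cz * |U| * (cDtmin (-1.2) (-0.05) / 2))
    -- (B) the multi-slot sizes at scale `n + 1`, by name (opened in `…TwoLegStepSuccDoorMS`)
    (hms : TwoLegSizesMSTQ L M G Q R β U μ K (n + 1))

    -- (C) the two nested-leg rates at scale `n + 1`
    (hcut : ∀ (Mq : ℕ → ℕ) (L₁ M₁ M₂ : ℕ) [NeZero L₁] [NeZero M₁] [NeZero M₂], L ≤ L₁ → Q.M0 β L₁ ≤ M₁ → Mq L₁ ≤ M₁ → M₁ ≤ M₂ →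
      (∀ j < n + 1, histV15 L₁ M₁ G P Q R β U μ K j ∧
        TwoLegCoreTD L₁ M₁ (histV15 L₁ M₁ G P Q R β U μ) G P Q R β U μ K j ∧
          TwoLegSizesMSTQ L₁ M₁ G Q R β U μ K j) →
      (∀ j < n + 1, histV15 L₁ M₂ G P Q R β U μ K j ∧
        TwoLegCoreTD L₁ M₂ (histV15 L₁ M₂ G P Q R β U μ) G P Q R β U μ K j ∧
          TwoLegSizesMSTQ L₁ M₂ G Q R β U μ K j) →
        ∀ θ : ℝ, |klLocalPart L₁ M₁ β U μ K (n + 1) θ - klLocalPart L₁ M₂ β U μ K (n + 1) θ| ≤ Q.CL β (n + 1) / 4 / L₁)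
    (hsp : ∀ (Mq : ℕ → ℕ) (L₁ L₂ M₂ : ℕ) [NeZero L₁] [NeZero L₂] [NeZero M₂], L ≤ L₁ → L₁ ∣ L₂ → Q.M0 β L₁ ≤ M₂ → Mq L₁ ≤ M₂ →
      Q.M0 β L₂ ≤ M₂ → Mq L₂ ≤ M₂ →
      (∀ j < n + 1, histV15 L₁ M₂ G P Q R β U μ K j ∧
        TwoLegCoreTD L₁ M₂ (histV15 L₁ M₂ G P Q R β U μ) G P Q R β U μ K j ∧
          TwoLegSizesMSTQ L₁ M₂ G Q R β U μ K j) →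
      (∀ j < n + 1, histV15 L₂ M₂ G P Q R β U μ K j ∧
        TwoLegCoreTD L₂ M₂ (histV15 L₂ M₂ G P Q R β U μ) G P Q R β U μ K j ∧
          TwoLegSizesMSTQ L₂ M₂ G Q R β U μ K j) →
        ∀ θ : ℝ, |klLocalPart L₁ M₂ β U μ K (n + 1) θ - klLocalPart L₂ M₂ β U μ K (n + 1) θ| ≤ Q.CL β (n + 1) / 4 / L₁) :
    TwoLegStepV16 L M G P Q R β U μ K (n + 1) := by
  have hmono : ∀ k, curveJetBar cN cN' U k (n + 1) ≤ curveJetBar (fun k => G.S k / X k) (fun k => Q.S' k / X k) U k (n + 1) :=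
    fun k => curveJetBar_mono hpk hpk' U k (n + 1)
  have hA0 : ∀ θ : ℝ, |klLocalPart L M β U μ K (n + 1) θ - klLocalPart L M β U μ K n θ| ≤
      curveJetBar (fun k => G.S k / X k) (fun k => Q.S' k / X k) U 0 (n + 1) := fun θ => by
    have h := (hjets 0 (by norm_num) θ).trans (hmono 0)
    simpa only [iteratedDeriv_zero, klTwoLegCurveProfile_succ] using h
  have hA1 : ∀ θ : ℝ, |deriv (fun θ => klLocalPart L M β U μ K (n + 1) θ - klLocalPart L M β U μ K n θ) θ| ≤
      curveJetBar (fun k => G.S k / X k) (fun k => Q.S' k / X k) U 1 (n + 1) := fun θ => by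
    have h := (hjets 1 (by norm_num) θ).trans (hmono 1)
    simpa only [iteratedDeriv_one, klTwoLegCurveProfile_succ] using h
  have hA2 : ∀ θ : ℝ, |iteratedDeriv 2 (fun θ => klLocalPart L M β U μ K (n + 1) θ - klLocalPart L M β U μ K n θ) θ| ≤
      curveJetBar (fun k => G.S k / X k) (fun k => Q.S' k / X k) U 2 (n + 1) := fun θ => by
    have h := (hjets 2 le_rfl θ).trans (hmono 2)
    simpa only [klTwoLegCurveProfile_succ] using h
  exact twoLegStepV16_succ_of_profileData_pkg G Q P R c hP hR hc hc3 μ hμ U hU hUle β hβ hβc K hK L M hL hM n hn hreg hhist hE hCL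
    (A := fun k => curveJetBar (fun k => G.S k / X k) (fun k => Q.S' k / X k) U k (n + 1)) hA0 hA1 hA2
    (profileFit_of_curveJetBar_div hS hS' hS12 hS'12 hX0 hX1 hX2 U (n + 1)) hd hnear hvK' hfitL hfar hz hm₁' hfit1 hms hcut hsp

end Summit.HubbardSuperconductivity.HubbardSuperconductivity.Theorems.EngineV8

end
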